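import Literature.AlgebraicGeometry.Resolution.AlterationsSemiStableThickness
import Literature.AlgebraicGeometry.Resolution.AlterationsBlowupDivisorProofs
import Literature.AlgebraicGeometry.Resolution.AlterationsLemma32
import Literature.AlgebraicGeometry.Resolution.BlowupsEquivariant
import Literature.AlgebraicGeometry.Resolution.BlowupsExistence
import HarnessLib

/-!
# `WildQuotients.SummitReduction` (stmt-ResolutionOfSingularities-16324), line `FramePerfect`:
# removing one `G`-orbit of codimension-2 singular components by repeated equivariant blow-ups (input (h1) of stub `stub_pair_ssCodimThree`)

Route `ResolutionOfSingularities/WildQuotients`, crux `SummitReduction`; helper file of the line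
skeleton `Cruxes/SummitReduction/Lines/FramePerfect.lean` (v6), stub A (`stub_pair_ssCodimThree`,
de Jong 1996, Lemma 3.2 made `G`-equivariant and quasi-split). The sibling files
`…StubPairSsCodimThreeLemmas` (stub A from (h0) `codim(Sing X, X) ≥ 2` and (h1) the equivariant
orbit modification) and `…StubPairSsCodimThreeCodimTwo` ((h0) discharged) leave (h1): a
`G`-equivariant modification removing the `G`-orbit of one codimension-2 singular point and
nothing else. This file is the equivariant analogue of the tree's
`DeJong1996SemiStableCodimTwoModification.of_thickness_of_blowup`
(`AlterationsSemiStableThickness.lean`): (h1), for an ARBITRARY predicate `Q` on curves over the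
`G`-base `(Y, ρ_Y)` (in the line: semi-stable, quasi-split, smooth over `Y ∖ D`), from

* (hT) **the invariant `n_T`** (de Jong 1996, 3.4): at a codimension-`≤ 2` singular point of a
  projective `Q`-curve, `2 ≤ n(x) < ∞` (`Scheme.Hom.nodeThickness`);
* (hB) **the Claim of 3.4 for ONE blow-up of the orbit** `Z = cl(G · x)` (de Jong 1997, proof of
  5.11, ¶1: "As `D` is `G`-strict, `T' = ⋃ g(T)` is a disjoint union", so the three charts of
  de Jong 1996, p. 64 apply along each `g(T)`): for ANY blowing up `π : X₁ ⟶ X` in the reduced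
  ideal of `Z`, `Q (π ≫ f)`, `π` maps codimension-`≤ 2` singular points to codimension-`≤ 2`
  singular points injectively, preserving `n` off the orbit and dropping it by `2` over it.

The blow-up itself, its `G`-action (`IsBlowup.liftAction`: the reduced ideal of the `G`-stable
`Z` is `G`-stable), its projectivity (`IsBlowup.isProjectiveOver`, Hartshorne II 7.16 (c)), that
it is a modification (`Z ≠ X`: the generic point is regular) and an isomorphism over the opens on
which `f` is smooth (they consist of regular points, EGA IV₄ 17.5.8 (iii), and `Z ⊆ Sing X`, the
regular locus of the variety `X` being open), and the induction on `n(x)` (the codimension-2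
singular points upstairs over the orbit form ONE orbit, by injectivity and equivariance) are
PROVED here: `orbitModification_of_thickness_of_orbitBlowup`.
-/

set_option linter.dupNamespace false

noncomputable section

open CategoryTheory CategoryTheory.Limits AlgebraicGeometry TopologicalSpace
open Literature.AlgebraicGeometry.Resolution
open Literature.AlgebraicGeometry
open Scheme.IdealSheafData

namespace Summit.ResolutionOfSingularities.ResolutionOfSingularities.Theorems

/-! ## Automorphisms, orbits and the codimension-2 singular points -/

/-- An isomorphism of schemes preserves the codimension-`≤ c` singular points (the stalks are
isomorphic). [folklore] -/
theorem mem_singularLocusCodimLE_of_iso {X X' : Scheme.{0}} (e : X ≅ X') {c : ℕ} {x : X}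
    (hx : x ∈ Scheme.singularLocusCodimLE X c) :
    e.hom.base x ∈ Scheme.singularLocusCodimLE X' c := by
  have i := (asIso (e.hom.stalkMap x)).commRingCatIsoToRingEquiv
  -- `i : 𝒪_{X', e x} ≃+* 𝒪_{X, x}`
  refine ⟨fun h => hx.1 ?_, ?_⟩
  · haveI := h
    exact IsRegularLocalRing.of_ringEquiv i
  · rw [ringKrullDim_eq_of_ringEquiv i]
    exact hx.2

/-- The orbit `G · x` of a point under an action `ρ : G →* Aut X` is `G`-stable:
`ρ(g)(G · x) = G · x`. [folklore] -/
theorem image_orbit_eq {X : Scheme.{0}} {G : Type} [Group G] (ρ : G →* Aut X) (x : X) (g : G) :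
    (ρ g).hom.base '' Set.range (fun h : G => (ρ h).hom.base x) =
      Set.range (fun h : G => (ρ h).hom.base x) := by
  have hmul : ∀ a b : G, (ρ a).hom.base ((ρ b).hom.base x) = (ρ (a * b)).hom.base x := fun a b => by
    rw [map_mul, ← Scheme.Hom.comp_apply]
    rfl
  ext y
  constructor
  · rintro ⟨_, ⟨h, rfl⟩, rfl⟩
    exact ⟨g * h, (hmul g h).symm⟩
  · rintro ⟨h, rfl⟩
    exact ⟨(ρ (g⁻¹ * h)).hom.base x, ⟨_, rfl⟩, by rw [hmul, mul_inv_cancel_left]⟩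

/-- The closure `Z = cl(G · x)` of an orbit is `G`-stable, in the preimage form used by
`IsBlowup.liftAction`: `ρ(g)⁻¹ Z = Z`. [folklore] -/
theorem preimage_closure_orbit_eq {X : Scheme.{0}} {G : Type} [Group G] (ρ : G →* Aut X) (x : X)
    (g : G) :
    (ρ g).hom.base ⁻¹' closure (Set.range fun h : G => (ρ h).hom.base x) =
      closure (Set.range fun h : G => (ρ h).hom.base x) := by
  have hmul : ∀ a b : G, (ρ b).hom ≫ (ρ a).hom = (ρ (a * b)).hom := fun a b => by
    rw [map_mul]
    rfl
  -- images first: `ρ(g) cl(G·x) ⊆ cl(ρ(g) G·x) = cl(G·x)` for every `g`, hence equality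
  have hsub : ∀ g : G, (ρ g).hom.base '' closure (Set.range fun h : G => (ρ h).hom.base x) ⊆
      closure (Set.range fun h : G => (ρ h).hom.base x) := fun g =>
    (image_closure_subset_closure_image (ρ g).hom.base.hom.continuous).trans
      (by rw [image_orbit_eq])
  have himage : ∀ g : G, (ρ g).hom.base '' closure (Set.range fun h : G => (ρ h).hom.base x) =
      closure (Set.range fun h : G => (ρ h).hom.base x) := fun g => by
    refine (hsub g).antisymm fun y hy => ⟨(ρ g⁻¹).hom.base y, hsub g⁻¹ ⟨y, hy, rfl⟩, ?_⟩
    rw [← Scheme.Hom.comp_apply, hmul, mul_inv_cancel, map_one]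
    rfl
  have hinv : (ρ g).inv = (ρ g⁻¹).hom := by
    rw [map_inv, Aut.Aut_inv_def]
    rfl
  rw [← image_inv_eq_preimage_hom, hinv]
  exact himage g⁻¹

/-! ## The blow-up of the orbit closure of a singular point -/

section Blowup

variable {k : Type} [Field k] {X Y : Scheme.{0}} (f : X ⟶ Y) (q : Y ⟶ Spec (.of k))

/-- For `X` of finite type over a field, the closure of a set of non-regular points consists of
non-regular points (the regular locus is open, Matsumura §30). [cite: Matsumura1987, §30, Cor. to Thm. 30.5] -/
theorem closure_subset_not_isRegularLocalRing [LocallyOfFiniteType (f ≫ q)] {S : Set X}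
    (hS : ∀ y ∈ S, ¬ IsRegularLocalRing (X.presheaf.stalk y)) {y : X} (hy : y ∈ closure S) :
    ¬ IsRegularLocalRing (X.presheaf.stalk y) := by
  have hcl : closure S ⊆ (Scheme.regularLocus X)ᶜ :=
    closure_minimal (fun z hz hreg => hS z hz hreg)
      (isOpen_regularLocus_of_locallyOfFiniteType_field (f ≫ q)).isClosed_compl
  exact hcl hy

/-- The reduced ideal sheaf of a closed subset of non-regular points of the integral `X` is
non-zero: the subset misses the (regular) generic point. [folklore] -/
theorem vanishingIdeal_ne_bot_of_not_isRegularLocalRing [IsIntegral X] {Z : Set X} (hZ : IsClosed Z)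
    (hZs : ∀ y ∈ Z, ¬ IsRegularLocalRing (X.presheaf.stalk y)) :
    vanishingIdeal ⟨Z, hZ⟩ ≠ ⊥ := by
  intro hbot
  have hsupp : Z = Set.univ := by
    have := congrArg (fun I : X.IdealSheafData => ((I.support : Closeds X) : Set X)) hbot
    simpa [coe_support_vanishingIdeal, support_bot] using this
  refine hZs (genericPoint X) (by rw [hsupp]; trivial) ?_
  show IsRegularLocalRing X.functionField
  infer_instance

/-- An open consisting of regular points lies in the complement of the reduced centre on a closed
subset of non-regular points. [folklore] -/
theorem le_centreCompl_vanishingIdeal {Z : Set X} (hZ : IsClosed Z)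
    (hZs : ∀ y ∈ Z, ¬ IsRegularLocalRing (X.presheaf.stalk y)) {U : X.Opens}
    (hU : ∀ y ∈ U, IsRegularLocalRing (X.presheaf.stalk y)) :
    U ≤ centreCompl (vanishingIdeal ⟨Z, hZ⟩) := by
  intro y hyU hy
  have hy' : y ∈ Z := by
    have := coe_support_vanishingIdeal (X := X) ⟨Z, hZ⟩
    have hy2 : y ∈ ((vanishingIdeal ⟨Z, hZ⟩).support : Set X) := hy
    rw [this] at hy2
    exact hy2
  exact hZs y hy' (hU y hyU)

end Blowup

/-! ## (h1) from the invariant `n_T` and the Claim of 3.4 along one orbit -/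

/-- **De Jong 1996, 3.4 iterated along one `G`-orbit** (de Jong 1997, proof of Prop. 5.11, ¶1),
the equivariant analogue of `DeJong1996SemiStableCodimTwoModification.of_thickness_of_blowup`.
Fix a field `k`, a regular locally Noetherian `G`-base `Y → Spec k` and a predicate `Q` on curves
`f : X ⟶ Y`. Assume (hT): at every codimension-`≤ 2` singular point `x` of an integral projective
`X` carrying a `Q`-curve, `2 ≤ n(x) < ∞` (`Scheme.Hom.nodeThickness`, the invariant `n_T` of 3.4);
and (hB): for every `G`-equivariant `Q`-curve `f : X ⟶ Y` on an integral projective `X`, every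
codimension-`≤ 2` singular point `x` and EVERY blowing up `π : X₁ ⟶ X` of `X` in the reduced ideal
of the orbit closure `cl(G · x)`, one has `Q (π ≫ f)`, and `π` maps the codimension-`≤ 2`
singular points of `X₁` into those of `X`, injectively, preserving `n` off the orbit of `x` and
with `n(x₁) + 2 = n(x)` at the points `x₁` over the orbit. Then (h1) of
`stub_pair_ssCodimThree_of_singCodimTwo_of_orbitModification` holds for `P = projective ∧ Q`:
every such `x` is removed, with its orbit and nothing else, by a `G`-equivariant projective
modification `φ`, an isomorphism over the opens on which `f` is smooth, with `Q (φ ≫ f)`. Proof: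
induction on `n(x)`; blow up `Z = cl(G · x)` (it exists, `exists_isBlowup`; it is a modification as
`Z ⊆ Sing X ∌ η`; projective by Hartshorne II 7.16 (c); `G` acts by `IsBlowup.liftAction`, `Z`
being `G`-stable; it is an isomorphism off `Z`, in particular over the smooth opens, whose points
are regular); if no codimension-2 singular point of `X₁` lies over the orbit we are done, otherwise
those that do form ONE `G`-orbit (injectivity and equivariance of `π`) of thickness `n(x) - 2`, and
we compose with the modification given by induction. [cite: DeJong1996, 3.4, pp. 63–64]
[cite: DeJong1997, proof of Prop. 5.11, p. 618] -/
theorem orbitModification_of_thickness_of_orbitBlowup {k : Type} [Field k] {Y : Scheme.{0}}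
    [IsLocallyNoetherian Y] (q : Y ⟶ Spec (.of k)) (hreg : Scheme.IsRegular Y) {G : Type}
    [Group G] (ρY : G →* Aut Y) (Q : ∀ ⦃X : Scheme.{0}⦄, (X ⟶ Y) → Prop)
    (hT : ∀ (X : Scheme.{0}) [IsIntegral X] (f : X ⟶ Y),
      Motives.IsProjectiveOver (Over.mk (f ≫ q)) → Q f → ∀ x ∈ Scheme.singularLocusCodimLE X 2,
        2 ≤ Scheme.Hom.nodeThickness f x ∧ Scheme.Hom.nodeThickness f x ≠ ⊤)
    (hB : ∀ (X : Scheme.{0}) [IsIntegral X] (f : X ⟶ Y) (ρX : G →* Aut X),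
      Motives.IsProjectiveOver (Over.mk (f ≫ q)) → Q f →
      (∀ g : G, (ρX g).hom ≫ f = f ≫ (ρY g).hom) → ∀ x ∈ Scheme.singularLocusCodimLE X 2,
      ∀ (X₁ : Scheme.{0}) (π : X₁ ⟶ X),
        IsBlowup π (vanishingIdeal
          ⟨closure (Set.range fun g : G => (ρX g).hom.base x), isClosed_closure⟩) →
        Q (π ≫ f) ∧
        Set.MapsTo π.base (Scheme.singularLocusCodimLE X₁ 2) (Scheme.singularLocusCodimLE X 2) ∧
        Set.InjOn π.base (Scheme.singularLocusCodimLE X₁ 2) ∧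
        (∀ x₁ ∈ Scheme.singularLocusCodimLE X₁ 2,
          π.base x₁ ∉ Set.range (fun g : G => (ρX g).hom.base x) →
            Scheme.Hom.nodeThickness (π ≫ f) x₁ = Scheme.Hom.nodeThickness f (π.base x₁)) ∧
        (∀ x₁ ∈ Scheme.singularLocusCodimLE X₁ 2,
          π.base x₁ ∈ Set.range (fun g : G => (ρX g).hom.base x) →
            Scheme.Hom.nodeThickness (π ≫ f) x₁ + 2 = Scheme.Hom.nodeThickness f x))
    (X : Scheme.{0}) [IsIntegral X] (f : X ⟶ Y) (ρX : G →* Aut X)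
    (hP : Motives.IsProjectiveOver (Over.mk (f ≫ q)) ∧ Q f)
    (hρf : ∀ g : G, (ρX g).hom ≫ f = f ≫ (ρY g).hom) (x : X)
    (hx : x ∈ Scheme.singularLocusCodimLE X 2) :
    ∃ (X' : Scheme.{0}) (_ : IsIntegral X') (φ : X' ⟶ X) (ρX' : G →* Aut X'),
      IsModification φ ∧ (∀ g : G, (ρX' g).hom ≫ φ = φ ≫ (ρX g).hom) ∧
      (Motives.IsProjectiveOver (Over.mk ((φ ≫ f) ≫ q)) ∧ Q (φ ≫ f)) ∧
      (∀ U : X.Opens, Smooth (U.ι ≫ f) → IsIso (φ ∣_ U)) ∧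
      Set.MapsTo φ.base (Scheme.singularLocusCodimLE X' 2)
        (Scheme.singularLocusCodimLE X 2 \ Set.range fun g : G => (ρX g).hom.base x) ∧
      Set.InjOn φ.base (Scheme.singularLocusCodimLE X' 2) := by
  -- induction on `n(x)`, over all equivariant projective `Q`-curves on `(Y, ρ_Y)`
  suffices H : ∀ (N : ℕ) (X : Scheme.{0}) [IsIntegral X] (f : X ⟶ Y) (ρX : G →* Aut X),
      Motives.IsProjectiveOver (Over.mk (f ≫ q)) → Q f →
      (∀ g : G, (ρX g).hom ≫ f = f ≫ (ρY g).hom) → ∀ x ∈ Scheme.singularLocusCodimLE X 2,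
      Scheme.Hom.nodeThickness f x ≤ N →
        ∃ (X' : Scheme.{0}) (_ : IsIntegral X') (φ : X' ⟶ X) (ρX' : G →* Aut X'),
          IsModification φ ∧ (∀ g : G, (ρX' g).hom ≫ φ = φ ≫ (ρX g).hom) ∧
          (Motives.IsProjectiveOver (Over.mk ((φ ≫ f) ≫ q)) ∧ Q (φ ≫ f)) ∧
          (∀ U : X.Opens, Smooth (U.ι ≫ f) → IsIso (φ ∣_ U)) ∧
          Set.MapsTo φ.base (Scheme.singularLocusCodimLE X' 2)
            (Scheme.singularLocusCodimLE X 2 \ Set.range fun g : G => (ρX g).hom.base x) ∧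
          Set.InjOn φ.base (Scheme.singularLocusCodimLE X' 2) by
    obtain ⟨N, hN⟩ := ENat.ne_top_iff_exists.mp (hT X f hP.1 hP.2 x hx).2
    exact H N X f ρX hP.1 hP.2 hρf x hx hN.symm.le
  intro N
  induction N with
  | zero =>
    intro X _ f ρX hproj hQ hρf x hx hN
    exact absurd (le_trans (hT X f hproj hQ x hx).1 hN) (by decide)
  | succ N ih =>
    intro X _ f ρX hproj hQ hρf x hx hN
    have hmulX : ∀ a b : G, (ρX b).hom ≫ (ρX a).hom = (ρX (a * b)).hom := fun a b => by
      rw [map_mul]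
      rfl
    haveI := DeJong1996.isNoetherian_of_isProjectiveOver (f ≫ q) hproj
    haveI : IsProper (f ≫ q) := Motives.IsProjectiveOver.isProper (X := Over.mk (f ≫ q)) hproj
    -- the centre: the orbit closure `Z = cl(G · x) ⊆ Sing X`, a `G`-stable closed subset
    set orb : Set X := Set.range fun g : G => (ρX g).hom.base x with horb
    have horbs : ∀ y ∈ orb, ¬ IsRegularLocalRing (X.presheaf.stalk y) := by
      rintro _ ⟨g, rfl⟩
      exact (mem_singularLocusCodimLE_of_iso (ρX g) hx).1
    have hZs : ∀ y ∈ closure orb, ¬ IsRegularLocalRing (X.presheaf.stalk y) := fun y hy =>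
      closure_subset_not_isRegularLocalRing f q horbs hy
    let J : X.IdealSheafData := vanishingIdeal ⟨closure orb, isClosed_closure⟩
    obtain ⟨X₁, π, hπ⟩ := exists_isBlowup X J
    have hJ : J ≠ ⊥ := vanishingIdeal_ne_bot_of_not_isRegularLocalRing isClosed_closure hZs
    have hπm : IsModification π := IsModification.of_isBlowup hπ hJ
    haveI := hπm.isIntegral
    have hproj₁ : Motives.IsProjectiveOver (Over.mk ((π ≫ f) ≫ q)) := by
      rw [Category.assoc]
      exact hπ.isProjectiveOver (f ≫ q) hproj
    -- the `G`-action lifts (the reduced ideal of the `G`-stable `Z` is `G`-stable)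
    have hZG : ∀ g : G, (ρX g).hom.base ⁻¹'
        ((⟨closure orb, isClosed_closure⟩ : Closeds X) : Set X) = closure orb := fun g =>
      preimage_closure_orbit_eq ρX x g
    let ρX₁ : G →* Aut X₁ := hπ.liftAction ρX (vanishingIdeal_comap_eq_of_action ρX _ hZG)
    have hequiv₁ : ∀ g : G, (ρX₁ g).hom ≫ π = π ≫ (ρX g).hom := fun g =>
      hπ.liftAction_hom_comp ρX _ g
    have hρf₁ : ∀ g : G, (ρX₁ g).hom ≫ π ≫ f = (π ≫ f) ≫ (ρY g).hom := fun g => by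
      rw [← Category.assoc, hequiv₁ g, Category.assoc, hρf g, Category.assoc]
    -- (i): `π` is an isomorphism over the opens on which `f` is smooth (regular points, off `Z`)
    have hiso : ∀ U : X.Opens, Smooth (U.ι ≫ f) → IsIso (π ∣_ U) := fun U hU =>
      isIso_morphismRestrict_of_le π hπ.isIso_compl
        (le_centreCompl_vanishingIdeal isClosed_closure hZs fun y hyU => by
          haveI : IsRegularLocalRing ((U : Scheme.{0}).presheaf.stalk ⟨y, hyU⟩) :=
            isRegularLocalRing_stalk_of_smooth (U.ι ≫ f) ⟨y, hyU⟩ (hreg _)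
          exact IsRegularLocalRing.of_ringEquiv
            (asIso (U.ι.stalkMap ⟨y, hyU⟩)).commRingCatIsoToRingEquiv.symm)
    -- (ii), (iii): the Claim for the blow-up of the orbit
    obtain ⟨hQ₁, hmaps, hinj, hsame, hdrop⟩ := hB X f ρX hproj hQ hρf x hx X₁ π hπ
    by_cases hover : ∃ x₁ ∈ Scheme.singularLocusCodimLE X₁ 2, π.base x₁ ∈ orb
    · -- the codimension-2 singular points over the orbit: ONE orbit `G · x₁`, `n(x₁) = n(x) - 2`
      obtain ⟨x₁, hx₁, g₀, hg₀⟩ := hover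
      have hN₁ : Scheme.Hom.nodeThickness (π ≫ f) x₁ ≤ N := by
        apply ENat.le_of_add_two_le_add_one
        rw [hdrop x₁ hx₁ ⟨g₀, hg₀⟩]
        exact_mod_cast hN
      have horb₁ : ∀ y₁ ∈ Scheme.singularLocusCodimLE X₁ 2, π.base y₁ ∈ orb →
          y₁ ∈ Set.range fun g : G => (ρX₁ g).hom.base x₁ := by
        rintro y₁ hy₁ ⟨g, hg⟩
        refine ⟨g * g₀⁻¹, hinj (mem_singularLocusCodimLE_of_iso (ρX₁ (g * g₀⁻¹)) hx₁) hy₁ ?_⟩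
        have e₀ : π.base x₁ = (ρX g₀).hom.base x := hg₀.symm
        have e₁ : π.base y₁ = (ρX g).hom.base x := hg.symm
        rw [← Scheme.Hom.comp_apply, hequiv₁, Scheme.Hom.comp_apply, e₀, e₁,
          ← Scheme.Hom.comp_apply, hmulX, inv_mul_cancel_right]
      -- induction upstairs, then compose
      obtain ⟨X', hX', ψ, ρX', hψ, hequiv', hP', hisoψ, hmaps', hinj'⟩ :=
        ih X₁ (π ≫ f) ρX₁ hproj₁ hQ₁ hρf₁ x₁ hx₁ hN₁
      haveI := hX'
      refine ⟨X', hX', ψ ≫ π, ρX', hψ.comp hπm, fun g => ?_,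
        by simpa only [Category.assoc] using hP', fun U hU => ?_, fun x' hx' => ?_, ?_⟩
      · rw [← Category.assoc, hequiv' g, Category.assoc, hequiv₁ g, Category.assoc]
      · haveI h₁ : IsIso (π ∣_ U) := hiso U hU
        have h₂ : IsIso (ψ ∣_ π ⁻¹ᵁ U) := hisoψ (π ⁻¹ᵁ U) (DeJong1996.smooth_ι_comp_comp U π hU)
        rw [morphismRestrict_comp]
        exact @IsIso.comp_isIso _ _ _ _ _ _ _ h₂ h₁
      · have h1 := hmaps' hx'
        refine ⟨?_, fun hmem => h1.2 ?_⟩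
        · rw [Scheme.Hom.comp_apply]
          exact hmaps h1.1
        · rw [Scheme.Hom.comp_apply] at hmem
          exact horb₁ _ h1.1 hmem
      · intro x' hx' x'' hx'' heq
        simp only [Scheme.Hom.comp_apply] at heq
        exact hinj' hx' hx'' (hinj (hmaps' hx').1 (hmaps' hx'').1 heq)
    · -- no codimension-2 singular point over the orbit: the blow-up itself answers
      push Not at hover
      exact ⟨X₁, inferInstance, π, ρX₁, hπm, hequiv₁, ⟨hproj₁, hQ₁⟩, hiso,
        fun x₁ hx₁ => ⟨hmaps hx₁, hover x₁ hx₁⟩, hinj⟩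

end Summit.ResolutionOfSingularities.ResolutionOfSingularities.Theorems

end
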